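import Literature.AlgebraicGeometry.AbelianSchemes.PolarizedLevelLocallyRigidifiable
import Literature.AlgebraicGeometry.AbelianSchemes.AbelianSchemeOverHomNoetherianAnyBase
import Literature.AlgebraicGeometry.AbelianSchemes.TorsionSectionPullbackOfSymmetric
import Literature.AlgebraicGeometry.Modules.DeterminantSectionOfSections
import Literature.AlgebraicGeometry.Modules.PullbackFrame
import Literature.AlgebraicGeometry.Modules.EvaluationDeterminantFrameLocus
import Literature.AlgebraicGeometry.ModuliOfAbelianVarieties.SiegelLinearRigidificationUnique
import Literature.AlgebraicGeometry.ModuliOfAbelianVarieties.SiegelModuliFrameSubfunctor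
import Literature.AlgebraicGeometry.ModuliOfAbelianVarieties.SiegelLinearRigidificationBaseChange
import HarnessLib

/-!
# The frame minors of a polarised abelian scheme with level structure are sections of ONE line bundle

Layer `Literature/AlgebraicGeometry/ModuliOfAbelianVarieties`; namespace
`Literature.AlgebraicGeometry.AbelianSchemes.PolarizedAbelianSchemeWithLevel`.  THEOREMS ONLY (no definition, no named fact,
no instance, no notation, no `sorry`).  Cell `hodgecm-mathlib` (D-0151), F-DAG F-9 (quasi-projectivity of the Siegel moduli
scheme), road Q2 «intrinsic bundles» of the census `B-provers/B-p06/g13/CENSUS-F9-QuasiProjectivity.B-p06g13.md`, row (M1).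
HC_CM is proved only modulo the 7 printed citations until rung 0 closes; nothing here bears on a summit statement.

THE MATHEMATICS ([MumfordFogartyKirwan1994] Ch. 3 §1 and Ch. 7 §3, read INTRINSICALLY on the moduli functor).  For a triple
`P = (X/T, λ, σ)` over a quasi-compact locally Noetherian `ℚ`-scheme let `L′ = L^Δ(λ)^{⊗3}` on `X`, `E = π_*L′` (locally free of
rank `m + 1 = 6^g·d`, ★ `hasRank_pushforward_LDelta_three_of_compactSpace`) and `σ^a ∈ X(T)` (`a ∈ (ℤ/N)^{2g}`) the `N^{2g}` marked
torsion sections.  MFK's homogeneous coordinates of the marked point `σ^a` are the evaluation `ev_{σ^a} : E → (σ^a)^*L′`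
(★ `Modules/EvaluationDeterminant`), and his determinants `D_α = det [X_i^{(α_j)}]` are the evaluation determinants of an
`(m+1)`-tuple `α` read in frames (★ `FrameSystem.evalDet`, `Modules/DeterminantSectionOfSections`) — sections of
`(det E)⁻¹ ⊗ ⨂_j (σ^{α_j})^*L′`, a bundle that DEPENDS on `α`.  Since `σ^a` is `N`-torsion, `((σ^a)^*L′)^{⊗2N²} ≅ (e^*L′)^{⊗2N²}`
([MumfordAV1970] §6 Cor. 3 at the point `σ^a`; ★ `AbelianSchemes/TorsionSectionPullbackOfSymmetric`), so after the `2N²`-th power and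
a rescaling by the corresponding coboundaries ALL the products `F_R = ∏_k D_{R∖k}` over `(m+2)`-tuples `R` become sections of ONE
line bundle («torsion kills the label»; the device behind the `PGL`-invariant sections of MFK Ch. 3 §1 p. 74 and Thm. 7.9).  In the
tree's COEFFICIENT currency (no tensor products of modules are formed): the coefficient families form a single
★ `GeneratingSections.CocycleSections` datum, and their non-vanishing loci are the common loci of the minors.

* §1 `exists_pow_unitCocycle` («`[c]^n` is represented by `g^n`»), `nonempty_coboundary_of_mk_eq`,
  `sectionPow_level_pow_eq_one` («`(σ^a)^N = 1`», over ★ `isCommMonObj_of_isLocallyNoetherian_base`), `sectionPow_left_comp_hom`;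
* §2 **`exists_cocycleSections_basicOpen_eq_inf_evalDet`** — the theorem.

The identification of these loci with MFK's opens `U_R(P)` (★ `frameOpen`, F-8 (8β)) is the sequel (same file, edition 2), over
★ `AbelianSchemes/PolarizedLevelLocallyRigidifiable` §4 and ★ `Modules/EvaluationDeterminantFrameLocus`.

EDITION 2 (append-only; §1–§2 byte-identical):
* §3 **`exists_cocycleSections_frameOpen`** — THE LOCI ARE MFK's OPENS: `⨆_t T_{S R t} = U_R(P)` (★ `frameOpen`) for every
  `(m+2)`-tuple `R`, over ★ `exists_frame_transport_of_frame` (`PolarizedLevelLocallyRigidifiable` §4), ★ `frameOpen_inf_eq`,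
  ★ (hGL) `exists_openCover_GL_of_isLinearRigidification`, ★ `inf_frameLocus_eq_inf_iInf_basicOpen_evalDet` and «evaluation at a
  section commutes with base change» (★ `Modules/EvaluationDeterminant` §2, `coord_evalAtSection_pushforwardBaseChangeHom_unitSection`,
  bytes A-p14 (g12)).

## References
* [MumfordFogartyKirwan1994] D. Mumford, J. Fogarty, F. Kirwan, *Geometric Invariant Theory*, 3rd ed. (1994), Ch. 3 §1 Def. 3.3 (p. 68)
  and p. 74; Ch. 7 §2 Def. 7.1 (p. 129), §3 Prop. 7.7 and Thm. 7.9 (pp. 138–139).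
* [MumfordAV1970] D. Mumford, *Abelian Varieties* (1970), §6 Cor. 3 (p. 59).
* [Hartshorne1977] R. Hartshorne, *Algebraic Geometry* (1977), II Ex. 5.16; III Ex. 4.5.
-/

set_option autoImplicit false

open CategoryTheory CategoryTheory.Limits AlgebraicGeometry Opposite TopologicalSpace MonoidalCategory
  CartesianMonoidalCategory
open scoped MonObj
namespace Literature.AlgebraicGeometry.AbelianSchemes

open Literature.AlgebraicGeometry.Motives Literature.AlgebraicGeometry.Modules
  Literature.AlgebraicGeometry.ModuliOfAbelianVarieties

namespace PolarizedAbelianSchemeWithLevel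

variable {g N : ℕ} {δ : Fin g → ℕ}

/-! ## §1 Bookkeeping: powers of cocycles, torsion of the marked sections -/

/-- **Powers of a unit cocycle represent powers of its class**: for a cocycle `c` and `n : ℕ` there is a cocycle on
the same opens with transition functions `g_{xy}^n` whose class is `[c]^n` (Hartshorne III Ex. 4.5: `Ȟ¹(X, 𝒪^×)` is a
group under pointwise product). [cite: Hartshorne1977, III Ex. 4.5] -/
theorem exists_pow_unitCocycle {X : Scheme.{0}} (c : UnitCocycle X) (n : ℕ) :
    ∃ (c' : UnitCocycle X) (hU : ∀ x, c.U x ≤ c'.U x),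
      (∀ (x y : X) (V : X.Opens) (hx : V ≤ c.U x) (hy : V ≤ c.U y),
        c'.g x y V (hx.trans (hU x)) (hy.trans (hU y)) = c.g x y V hx hy ^ n) ∧
      CechPic.mk c' = CechPic.mk c ^ n := by
  let p : UnitCocycle X :=
    { U := c.U
      mem := c.mem
      g := fun x y V hx hy => c.g x y V hx hy ^ n
      map_g := fun x y V V' hx hy i => by rw [map_pow, c.map_g]
      g_mul := fun x y z V hx hy hz => by rw [← mul_pow, c.g_mul]
      g_self := fun x V hx => by rw [c.g_self, one_pow] }
  refine ⟨p, fun x => le_rfl, fun x y V hx hy => rfl, ?_⟩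
  induction n with
  | zero =>
    rw [pow_zero, ← CechPic.mk_one]
    refine CechPic.sound (UnitCocycle.equiv_of_eq _ _ c.U c.mem (fun x => le_rfl) (fun x => le_top) ?_)
    intro x y V hx hy
    change (1 : Γ(X, V)) = c.g x y V hx hy ^ 0
    rw [pow_zero]
  | succ k ih =>
    -- `p_{k+1}` vs `p_k · c`
    let pk : UnitCocycle X :=
      { U := c.U
        mem := c.mem
        g := fun x y V hx hy => c.g x y V hx hy ^ k
        map_g := fun x y V V' hx hy i => by rw [map_pow, c.map_g]
        g_mul := fun x y z V hx hy hz => by rw [← mul_pow, c.g_mul]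
        g_self := fun x V hx => by rw [c.g_self, one_pow] }
    have hk : CechPic.mk pk = CechPic.mk c ^ k := ih
    rw [pow_succ, ← hk, ← CechPic.mk_mul]
    refine CechPic.sound (UnitCocycle.equiv_of_eq _ _ c.U c.mem (fun x => le_rfl)
      (fun x => le_inf le_rfl le_rfl) ?_)
    intro x y V hx hy
    change c.g x y V _ _ ^ k * c.g x y V _ _ = c.g x y V hx hy ^ (k + 1)
    rw [pow_succ]

/-- **Equal classes give a coboundary** (the two cocycles are cohomologous). [cite: Hartshorne1977, III Ex. 4.5] -/
theorem nonempty_coboundary_of_mk_eq {X : Scheme.{0}} {c c' : UnitCocycle X} (h : CechPic.mk c = CechPic.mk c') :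
    Nonempty (UnitCocycle.Coboundary c c') :=
  (CechPic.mk_eq_mk_iff c c').1 h

/-- **The marked sections are `N`-torsion**: `(σ^a)^N = 1` in the (commutative) group `X(S)` of sections — each basis
section is `N`-torsion (`LevelStructure.pow_σ`) and `X(S)` is commutative over a locally Noetherian base (★ Cor. 6.5,
`isCommMonObj_of_isLocallyNoetherian_base`). [cite: MumfordFogartyKirwan1994, Ch. 7 §2 Definition 7.1 (p. 129)] -/
theorem sectionPow_level_pow_eq_one {T : Scheme.{0}} [IsLocallyNoetherian T] (P : PolarizedAbelianSchemeWithLevel g N δ T)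
    (a : Fin g ⊕ Fin g → ZMod N) : P.A.sectionPow P.level.σ a ^ N = 1 := by
  haveI := P.A.isCommMonObj_of_isLocallyNoetherian_base
  have hcomm : ∀ x y : P.A.Sections, x * y = y * x := fun x y => mul_comm x y
  have hpow : ∀ (l : List P.A.Sections), (∀ x ∈ l, x ^ N = 1) → l.prod ^ N = 1 := by
    intro l hl
    induction l with
    | nil => simp
    | cons x l ih =>
      rw [List.prod_cons, mul_pow, hl x (List.mem_cons_self ..), one_mul]
      exact ih fun y hy => hl y (List.mem_cons_of_mem _ hy)
  have hσ : ∀ i (k : ℕ), (P.level.σ i ^ k) ^ N = 1 := fun i k => by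
    rw [← pow_mul, mul_comm, pow_mul, P.level.pow_σ i, one_pow]
  rw [AbelianSchemeOver.sectionPow, mul_pow, hpow _ ?_, hpow _ ?_, one_mul]
  · intro x hx
    rw [List.mem_ofFn] at hx
    obtain ⟨i, rfl⟩ := hx
    exact hσ _ _
  · intro x hx
    rw [List.mem_ofFn] at hx
    obtain ⟨i, rfl⟩ := hx
    exact hσ _ _

/-- The marked section `σ^a` is a section of `X → T`. [cite: MumfordFogartyKirwan1994, Ch. 7 §2 Definition 7.1 (p. 129)] -/
theorem sectionPow_left_comp_hom {T : Scheme.{0}} (P : PolarizedAbelianSchemeWithLevel g N δ T)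
    (a : Fin g ⊕ Fin g → ZMod N) : (P.A.sectionPow P.level.σ a).left ≫ P.A.X.hom = 𝟙 T := by
  simpa using (P.A.sectionPow P.level.σ a).w

/-! ## §2 The frame minors of a triple are sections of ONE line bundle -/

/-- Restricting twice is restricting once. [folklore] -/
private theorem res_res' {X : Scheme.{0}} {U V V' : X.Opens} (h₁ : V ≤ U) (h₂ : V' ≤ V) (s : Γ(X, U)) :
    X.presheaf.map (homOfLE h₂).op (X.presheaf.map (homOfLE h₁).op s) =
      X.presheaf.map (homOfLE (h₂.trans h₁)).op s := by
  rw [← CommRingCat.comp_apply, ← Functor.map_comp]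
  rfl

/-- The non-vanishing locus of a finite product is the intersection of the loci (within the open). [folklore] -/
private theorem basicOpen_prod_eq_inf {X : Scheme.{0}} {U : X.Opens} {κ : Type*} (s : Finset κ) (f : κ → Γ(X, U)) :
    X.basicOpen (∏ i ∈ s, f i) = U ⊓ s.inf fun i => X.basicOpen (f i) := by
  classical
  induction s using Finset.induction_on with
  | empty => rw [Finset.prod_empty, Finset.inf_empty, X.basicOpen_of_isUnit isUnit_one, inf_top_eq]
  | insert i s hi ih =>
    rw [Finset.prod_insert hi, X.basicOpen_mul, ih, Finset.inf_insert, ← inf_assoc,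
      inf_eq_left.mpr (X.basicOpen_le (f i)), ← inf_assoc, inf_eq_right.mpr (X.basicOpen_le (f i))]

/-- Membership in a finite infimum of opens. [folklore] -/
private theorem mem_finset_inf {X : Scheme.{0}} {κ : Type*} (s : Finset κ) (f : κ → X.Opens) (x : X) :
    x ∈ s.inf f ↔ ∀ i ∈ s, x ∈ f i := by
  classical
  induction s using Finset.induction_on with
  | empty => simp
  | insert i s hi ih =>
    rw [Finset.inf_insert, Opens.mem_inf, ih]
    simp

/-- **THE FRAME MINORS OF A POLARISED ABELIAN SCHEME WITH LEVEL STRUCTURE ARE SECTIONS OF ONE LINE BUNDLE.**  For a triple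
`P = (X/T, λ, σ)` over a quasi-compact locally Noetherian `ℚ`-scheme, with `L′ = L^Δ(λ)^{⊗3}`, `E = π_*L′` (locally free of
rank `m + 1 = 6^g·d`, ★ `hasRank_pushforward_LDelta_three_of_compactSpace`) and the `N^{2g}` marked torsion sections
`σ^a`, choose frame systems `F` of `E` and `G_a` of `(σ^a)^*L′`; MFK's determinants `D_{R,k} = det [ev_{σ^{R j}}]_{j ≠ k}`
([MumfordFogartyKirwan1994] Ch. 3 §1, the minors of the `(m+2)`-tuple `R` of marked points; ★ `FrameSystem.evalDet`) are
then coefficients of sections of DIFFERENT bundles `(det E)⁻¹ ⊗ ⨂_{j≠k} (σ^{R j})^*L′`; but `(σ^a)^*L′^{⊗2N²} ≅ (e^*L′)^{⊗2N²}`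
for every `a` ([MumfordAV1970] §6 Cor. 3 at the `N`-torsion point `σ^a`, ★ `pullback_section_pow_eq_of_pow_eq_one`), so
after the `2N²`-th power and a rescaling by the coboundaries all `F_R := ∏_k D_{R,k}` become sections of ONE line bundle:
there is a `CocycleSections` datum `S` (★ `GeneratingSections.CocycleSections`) indexed by ALL `(m+2)`-tuples `R`, whose
non-vanishing loci are exactly the common non-vanishing loci of the minors, `T_{S R t} = W_t ∩ ⋂_k T_{D_{R,k}(t)}` — the
«torsion kills the label» step of the quasi-projectivity of `𝒜_{g,d,n}` ([MumfordFogartyKirwan1994] Ch. 7 §3).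
[cite: MumfordFogartyKirwan1994, Ch. 3 §1 Definition 3.3 (p. 68) and Ch. 7 §3 Prop. 7.7 (pp. 138–139)]
[cite: MumfordAV1970, §6 Cor. 3 (p. 59)] -/
theorem exists_cocycleSections_basicOpen_eq_inf_evalDet {T : Scheme.{0}} [IsLocallyNoetherian T] [CompactSpace T]
    (πT : T ⟶ Spec (.of ℚ)) (P : PolarizedAbelianSchemeWithLevel g N δ T) {m : ℕ}
    (hm : m + 1 = 6 ^ g * polarizationDegree δ) (hN : 0 < N)
    (Gr : P.A.X.left ⟶ P.A.prodLeft P.D.hat) (hGr₁ : Gr ≫ pullback.fst P.A.X.hom P.D.hat.X.hom = 𝟙 _)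
    (hGr₂ : Gr ≫ pullback.snd P.A.X.hom P.D.hat.X.hom = P.pol.lam.left) :
    ∃ (FE : FrameSystem ((Scheme.Modules.pushforward P.A.X.hom).obj
        (tensorPow ((Scheme.Modules.pullback Gr).obj P.D.P) 3))) (hFE : ∀ t, FE.rank t = m + 1)
      (G : ∀ a : Fin g ⊕ Fin g → ZMod N, FrameSystem ((Scheme.Modules.pullback (P.A.sectionPow P.level.σ a).left).obj
        (tensorPow ((Scheme.Modules.pullback Gr).obj P.D.P) 3))) (hG : ∀ a t, (G a).rank t = 1)
      (W : T → T.Opens) (_ : ∀ t, t ∈ W t) (hW : ∀ t, W t ≤ FE.U t) (hW' : ∀ a t, W t ≤ (G a).U t)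
      (S : GeneratingSections.CocycleSections (Fin (m + 2) → (Fin g ⊕ Fin g → ZMod N)) W),
      ∀ (R : Fin (m + 2) → (Fin g ⊕ Fin g → ZMod N)) (t : T),
        T.basicOpen (S.coeff R t) = W t ⊓ Finset.univ.inf fun k : Fin (m + 2) =>
          T.basicOpen (FrameSystem.evalDet
            (fun j => evalAtSection P.A.X.hom (P.A.sectionPow P.level.σ (R (k.succAbove j))).left
              (sectionPow_left_comp_hom P _) (tensorPow ((Scheme.Modules.pullback Gr).obj P.D.P) 3))
            FE hFE (fun j => G (R (k.succAbove j))) (fun _ => hG _) W hW (fun _ => hW' _) t) := by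
  classical
  haveI : NeZero N := ⟨hN.ne'⟩
  -- §2.0 the objects
  set L' : P.A.X.left.Modules := tensorPow ((Scheme.Modules.pullback Gr).obj P.D.P) 3 with hL'def
  have hL'1 : HasRank L' 1 := hasRank_tensorPow_one (hasRank_pullback Gr P.D.hasRank_one) 3
  have hL'f : IsFiniteLocallyFree L' := HasRank.isFiniteLocallyFree' hL'1
  set E : T.Modules := (Scheme.Modules.pushforward P.A.X.hom).obj L' with hEdef
  have hE : HasRank E (m + 1) := by
    rw [hm]; exact hasRank_pushforward_LDelta_three_of_compactSpace πT P Gr hGr₁ hGr₂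
  obtain ⟨FE, hFE⟩ := exists_frameSystem_of_hasRank hE
  -- the marked sections and the pulled-back line bundles
  let σ : (Fin g ⊕ Fin g → ZMod N) → P.A.Sections := fun a => P.A.sectionPow P.level.σ a
  have hσN : ∀ a, σ a ^ N = 1 := fun a => sectionPow_level_pow_eq_one P a
  let La : (Fin g ⊕ Fin g → ZMod N) → T.Modules := fun a => (Scheme.Modules.pullback (σ a).left).obj L'
  have hLa : ∀ a, HasRank (La a) 1 := fun a => hasRank_pullback _ hL'1
  have hG0 : ∀ a, ∃ G : FrameSystem (La a), ∀ t, G.rank t = 1 := fun a => exists_frameSystem_of_hasRank (hLa a)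
  choose G hG using hG0
  -- the base bundle `e^*L′` and its frame system
  let Le : T.Modules := (Scheme.Modules.pullback P.A.unitSection).obj L'
  obtain ⟨Ge, hGe⟩ := exists_frameSystem_of_hasRank (hasRank_pullback P.A.unitSection hL'1 : HasRank Le 1)
  -- §2.1 TORSION: `[G_a]^{2N²} = [G_e]^{2N²}`, hence coboundaries `λ_a`
  set K : ℕ := 2 * N ^ 2 with hKdef
  have hK : 0 < K := by positivity
  have hclass : ∀ a, CechPic.mk (G a).cocycle ^ K = CechPic.mk Ge.cocycle ^ K := by
    intro a
    have h1 : CechPic.mk (G a).cocycle = CechPic.pullback (σ a).left (detClass hL'f) :=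
      (detClass_eq_mk (hL'f.pullback (σ a).left) (G a)).symm.trans (detClass_pullback (σ a).left hL'f)
    have h2 : CechPic.mk Ge.cocycle = CechPic.pullback P.A.unitSection (detClass hL'f) :=
      (detClass_eq_mk (hL'f.pullback P.A.unitSection) Ge).symm.trans (detClass_pullback P.A.unitSection hL'f)
    rw [h1, h2]
    exact P.A.pullback_section_pow_eq_of_pow_eq_one (detClass hL'f) (σ a) (hσN a)
  have hcob : ∀ a, ∃ (pa pe : UnitCocycle T) (hUa : ∀ x, (G a).U x ≤ pa.U x) (hUe : ∀ x, Ge.U x ≤ pe.U x),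
      (∀ (x y : T) (V : T.Opens) (hx : V ≤ (G a).U x) (hy : V ≤ (G a).U y),
        pa.g x y V (hx.trans (hUa x)) (hy.trans (hUa y)) = (G a).cocycle.g x y V hx hy ^ K) ∧
      (∀ (x y : T) (V : T.Opens) (hx : V ≤ Ge.U x) (hy : V ≤ Ge.U y),
        pe.g x y V (hx.trans (hUe x)) (hy.trans (hUe y)) = Ge.cocycle.g x y V hx hy ^ K) ∧
      Nonempty (UnitCocycle.Coboundary pa pe) := by
    intro a
    obtain ⟨pa, hUa, hga, hmka⟩ := exists_pow_unitCocycle (G a).cocycle K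
    obtain ⟨pe, hUe, hge, hmke⟩ := exists_pow_unitCocycle Ge.cocycle K
    refine ⟨pa, pe, hUa, hUe, hga, hge, nonempty_coboundary_of_mk_eq ?_⟩
    rw [hmka, hmke]
    exact hclass a
  choose pa pe hUa hUe hga hge hlam using hcob
  let lam : ∀ a, UnitCocycle.Coboundary (pa a) (pe a) := fun a => (hlam a).some
  -- §2.2 the common refinement
  let W : T → T.Opens := fun t =>
    FE.U t ⊓ Ge.U t ⊓ Finset.univ.inf fun a => (G a).U t ⊓ (lam a).W t
  have hWF : ∀ t, W t ≤ FE.U t := fun t => inf_le_left.trans inf_le_left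
  have hWe : ∀ t, W t ≤ Ge.U t := fun t => inf_le_left.trans inf_le_right
  have hWG : ∀ a t, W t ≤ (G a).U t := fun a t =>
    inf_le_right.trans ((Finset.inf_le (Finset.mem_univ a)).trans inf_le_left)
  have hWlam : ∀ a t, W t ≤ (lam a).W t := fun a t =>
    inf_le_right.trans ((Finset.inf_le (Finset.mem_univ a)).trans inf_le_right)
  have hmemW : ∀ t, t ∈ W t := fun t => by
    refine ⟨⟨FE.mem t, Ge.mem t⟩, ?_⟩
    exact (mem_finset_inf _ _ t).mpr fun a _ => ⟨(G a).mem t, (lam a).mem t⟩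
  -- §2.3 the minors `D_{R,k}(t)`, the rescaled coefficients `c R t`, the transition functions
  let ψ : ∀ a, E ⟶ La a := fun a =>
    evalAtSection P.A.X.hom (σ a).left (sectionPow_left_comp_hom P a) L'
  let D : (Fin (m + 2) → (Fin g ⊕ Fin g → ZMod N)) → Fin (m + 2) → ∀ t : T, Γ(T, W t) := fun R k t =>
    FrameSystem.evalDet (fun j => ψ (R (k.succAbove j))) FE hFE (fun j => G (R (k.succAbove j)))
      (fun j => hG _) W hWF (fun j => hWG _) t
  let c : (Fin (m + 2) → (Fin g ⊕ Fin g → ZMod N)) → ∀ t : T, Γ(T, W t) := fun R t =>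
    ∏ k : Fin (m + 2), (D R k t ^ K * ∏ j : Fin (m + 1), (lam (R (k.succAbove j))).lam t (W t) (hWlam _ t))
  let gam : ∀ t s : T, Γ(T, W t ⊓ W s) := fun t s =>
    FE.cocycle.g t s (W t ⊓ W s) (inf_le_left.trans (hWF t)) (inf_le_right.trans (hWF s)) ^ K *
      (Ge.cocycle.g s t (W t ⊓ W s) (inf_le_right.trans (hWe s)) (inf_le_left.trans (hWe t)) ^ K) ^ (m + 1)
  -- units
  have hlamu : ∀ a t (V : T.Opens) (h : V ≤ (lam a).W t), IsUnit ((lam a).lam t V h) := by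
    intro a t V h
    exact IsUnit.of_mul_eq_one ((lam a).inv t V h) ((lam a).lam_mul_inv t V h)
  have hΓu : ∀ t s, IsUnit (gam t s ^ (m + 2)) := fun t s =>
    (((FE.cocycle.isUnit_g _ _ _ _ _).pow K).mul (((Ge.cocycle.isUnit_g _ _ _ _ _).pow K).pow _)).pow _
  -- §2.4 THE TRANSFORMATION LAW `c R s = gam^{m+2} · c R t` on `W t ⊓ W s`
  have hlaw : ∀ R (t s : T),
      T.presheaf.map (homOfLE (inf_le_right : W t ⊓ W s ≤ W s)).op (c R s) =
        gam t s ^ (m + 2) * T.presheaf.map (homOfLE (inf_le_left : W t ⊓ W s ≤ W t)).op (c R t) := by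
    intro R t s
    -- per-minor law
    have hk : ∀ k : Fin (m + 2),
        T.presheaf.map (homOfLE (inf_le_right : W t ⊓ W s ≤ W s)).op
            (D R k s ^ K * ∏ j : Fin (m + 1), (lam (R (k.succAbove j))).lam s (W s) (hWlam _ s)) =
          gam t s * T.presheaf.map (homOfLE (inf_le_left : W t ⊓ W s ≤ W t)).op
            (D R k t ^ K * ∏ j : Fin (m + 1), (lam (R (k.succAbove j))).lam t (W t) (hWlam _ t)) := by
      intro k
      have hev := FrameSystem.map_evalDet_eq_mul (fun j => ψ (R (k.succAbove j))) FE hFE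
        (fun j => G (R (k.succAbove j))) (fun j => hG _) W hWF (fun j => hWG _)
        (s := s) (t := t) (inf_le_right : W t ⊓ W s ≤ W s) (inf_le_left : W t ⊓ W s ≤ W t)
      -- the torsion relation for each column `j`
      have hrel : ∀ j : Fin (m + 1),
          (G (R (k.succAbove j))).cocycle.g s t (W t ⊓ W s) (inf_le_right.trans (hWG _ s))
              (inf_le_left.trans (hWG _ t)) ^ K *
            (lam (R (k.succAbove j))).lam s (W t ⊓ W s) (inf_le_right.trans (hWlam _ s)) =
          Ge.cocycle.g s t (W t ⊓ W s) (inf_le_right.trans (hWe s)) (inf_le_left.trans (hWe t)) ^ K *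
            (lam (R (k.succAbove j))).lam t (W t ⊓ W s) (inf_le_left.trans (hWlam _ t)) := by
        intro j
        have r := (lam (R (k.succAbove j))).rel s t (W t ⊓ W s) (inf_le_right.trans (hWlam _ s))
          (inf_le_left.trans (hWlam _ t))
        rw [hge _ s t (W t ⊓ W s) (inf_le_right.trans (hWe s)) (inf_le_left.trans (hWe t)),
          hga _ s t (W t ⊓ W s) (inf_le_right.trans (hWG _ s)) (inf_le_left.trans (hWG _ t))] at r
        rw [mul_comm, ← r, mul_comm]
      have hA : ∀ j : Fin (m + 1), T.presheaf.map (homOfLE (inf_le_right : W t ⊓ W s ≤ W s)).op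
          ((lam (R (k.succAbove j))).lam s (W s) (hWlam _ s)) =
          (lam (R (k.succAbove j))).lam s (W t ⊓ W s) (inf_le_right.trans (hWlam _ s)) := fun j =>
        (lam _).map_lam s (hWlam _ s) inf_le_right
      have hB : ∀ j : Fin (m + 1), T.presheaf.map (homOfLE (inf_le_left : W t ⊓ W s ≤ W t)).op
          ((lam (R (k.succAbove j))).lam t (W t) (hWlam _ t)) =
          (lam (R (k.succAbove j))).lam t (W t ⊓ W s) (inf_le_left.trans (hWlam _ t)) := fun j =>
        (lam _).map_lam t (hWlam _ t) inf_le_left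
      have hprod : (∏ j : Fin (m + 1), (G (R (k.succAbove j))).cocycle.g s t (W t ⊓ W s)
            (inf_le_right.trans (hWG _ s)) (inf_le_left.trans (hWG _ t)) ^ K) *
          (∏ j : Fin (m + 1), (lam (R (k.succAbove j))).lam s (W t ⊓ W s) (inf_le_right.trans (hWlam _ s))) =
          (Ge.cocycle.g s t (W t ⊓ W s) (inf_le_right.trans (hWe s)) (inf_le_left.trans (hWe t)) ^ K) ^ (m + 1) *
          ∏ j : Fin (m + 1), (lam (R (k.succAbove j))).lam t (W t ⊓ W s) (inf_le_left.trans (hWlam _ t)) := by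
        rw [← Finset.prod_mul_distrib, Finset.prod_congr rfl fun j _ => hrel j, Finset.prod_mul_distrib,
          Finset.prod_const, Finset.card_univ, Fintype.card_fin]
      simp only [map_mul, map_pow, map_prod, hA, hB]
      rw [hev, mul_pow, mul_pow, ← Finset.prod_pow]
      simp only [gam]
      linear_combination (FE.cocycle.g t s (W t ⊓ W s) (inf_le_left.trans (hWF t)) (inf_le_right.trans (hWF s)) ^ K *
        T.presheaf.map (homOfLE (inf_le_left : W t ⊓ W s ≤ W t)).op (D R k t) ^ K) * hprod
    simp only [c, map_prod]
    rw [Finset.prod_congr rfl fun k _ => hk k, Finset.prod_mul_distrib, Finset.prod_const, Finset.card_univ,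
      Fintype.card_fin]
  -- §2.5 the cocycle sections
  let S : GeneratingSections.CocycleSections (Fin (m + 2) → (Fin g ⊕ Fin g → ZMod N)) W :=
    GeneratingSections.CocycleSections.ofCocycle c (fun t s => gam t s ^ (m + 2))
      (fun R t s => hlaw R t s) (fun t s => hΓu t s)
  -- §2.6 loci
  refine ⟨FE, hFE, G, hG, W, hmemW, hWF, hWG, S, fun R t => ?_⟩
  change T.basicOpen (c R t) = _
  simp only [c]
  rw [basicOpen_prod_eq_inf]
  congr 1
  refine Finset.inf_congr rfl fun k _ => ?_
  rw [T.basicOpen_mul, T.basicOpen_pow _ hK, basicOpen_prod_eq_inf]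
  have hlamopen : (Finset.univ : Finset (Fin (m + 1))).inf
      (fun j => T.basicOpen ((lam (R (k.succAbove j))).lam t (W t) (hWlam _ t))) = W t := by
    rw [Finset.inf_congr rfl fun j _ => T.basicOpen_of_isUnit (hlamu _ _ _ _)]
    exact Finset.inf_const Finset.univ_nonempty _
  rw [hlamopen, inf_idem, inf_eq_left.mpr (T.basicOpen_le _)]
  rfl

end PolarizedAbelianSchemeWithLevel

end Literature.AlgebraicGeometry.AbelianSchemes

/-! # EDITION 2 -/

namespace Literature.AlgebraicGeometry.AbelianSchemes

open Literature.AlgebraicGeometry.Motives Literature.AlgebraicGeometry.Modules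
  Literature.AlgebraicGeometry.ModuliOfAbelianVarieties Literature.AlgebraicGeometry.Morphisms
  Literature.AlgebraicGeometry.Motives.GeneratingSections

namespace PolarizedAbelianSchemeWithLevel

variable {g N : ℕ} {δ : Fin g → ℕ}

/-! ## §3 The loci are MFK's opens `U_R(P)` -/

/-- Membership in a finite intersection of opens of a scheme. [folklore] -/
private theorem mem_iInf_iff {Y : Scheme.{0}} {κ : Type} [Finite κ] (U : κ → Y.Opens) (y : Y) :
    y ∈ ⨅ i, U i ↔ ∀ i, y ∈ U i := by
  change y ∈ ((⨅ i, U i : Y.Opens) : Set Y) ↔ _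
  rw [Opens.coe_iInf, Set.mem_iInter]
  rfl

set_option backward.isDefEq.respectTransparency false in
/-- **THE NON-VANISHING LOCI OF THE INTRINSIC SECTIONS ARE MFK'S OPENS `U_R(P)`** ([MumfordFogartyKirwan1994] Ch. 3 §1 Def. 3.3 with
Ch. 7 §2 Prop. 7.6: the open sub-functor «the `R`-marked torsion points are a projective frame» is cut out, on the base of ANY triple,
by the sections `F_R`): for a triple `P` over a quasi-compact locally Noetherian `ℚ`-scheme there is ONE cocycle-sections datum `S`,
indexed by all `(m+2)`-tuples `R`, with `⋃_t T_{S R t} = U_R(P)` (★ `frameOpen`) for every `R`.  Assembly of §2 (the minors read in a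
global frame system), ★ `exists_frame_transport_of_frame` (the frame of the chart IS a frame rigidification of `P|_U`), ★
`frameOpen_inf_eq` (any local rigidification computes `U_R`, given ★ (hGL) `exists_openCover_GL_of_isLinearRigidification`), ★
`inf_frameLocus_eq_inf_iInf_basicOpen_evalDet` (the frame locus is cut out by the evaluation minors) and «evaluation commutes with base
change» (`coord_evalAtSection_pushforwardBaseChangeHom_unitSection`). [cite: MumfordFogartyKirwan1994, Ch. 3 §1 Definition 3.3 (p. 68)]
[cite: MumfordFogartyKirwan1994, Ch. 7 §2 Prop. 7.6 (p. 136) and §3 Prop. 7.7 (pp. 138–139)] -/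
theorem exists_cocycleSections_frameOpen {T : Scheme.{0}} [IsLocallyNoetherian T] [CompactSpace T]
    (πT : T ⟶ Spec (.of ℚ)) (P : PolarizedAbelianSchemeWithLevel g N δ T) (J : Type) [Finite J]
    (hJ : Nat.card J + 1 = 6 ^ g * polarizationDegree δ) (hN : 0 < N) :
    ∃ (W : T → T.Opens) (S : GeneratingSections.CocycleSections (Fin (Nat.card J + 2) → (Fin g ⊕ Fin g → ZMod N)) W),
      ∀ R, ⨆ t, T.basicOpen (S.coeff R t) = frameOpen J P R := by
  classical
  -- the global graph datum
  let Gr : P.A.X.left ⟶ P.A.prodLeft P.D.hat :=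
    pullback.lift (𝟙 _) P.pol.lam.left (by rw [Category.id_comp, P.pol.lam_comp_hom])
  have hGr₁ : Gr ≫ pullback.fst P.A.X.hom P.D.hat.X.hom = 𝟙 _ := pullback.lift_fst _ _ _
  have hGr₂ : Gr ≫ pullback.snd P.A.X.hom P.D.hat.X.hom = P.pol.lam.left := pullback.lift_snd _ _ _
  let L' : P.A.X.left.Modules := tensorPow ((Scheme.Modules.pullback Gr).obj P.D.P) 3
  let E : T.Modules := (Scheme.Modules.pushforward P.A.X.hom).obj L'
  obtain ⟨FE, hFE, G, hG, W, hmem, hW, hW', S, hS⟩ :=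
    exists_cocycleSections_basicOpen_eq_inf_evalDet πT P hJ hN Gr hGr₁ hGr₂
  refine ⟨W, S, fun R => ?_⟩
  -- POINTWISE: `s ∈ U_R(P) ↔` all minors are units at `s`
  have key : ∀ s : T, s ∈ frameOpen J P R ↔ ∀ k : Fin (Nat.card J + 2), s ∈ T.basicOpen (FrameSystem.evalDet
      (fun j => evalAtSection P.A.X.hom (P.A.sectionPow P.level.σ (R (k.succAbove j))).left
        (sectionPow_left_comp_hom P _) L')
      FE hFE (fun j => G (R (k.succAbove j))) (fun _ => hG _) W hW (fun _ => hW' _) s) := by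
    intro s
    -- the chart of `s` and its frame, re-indexed by `Fin (#J + 1)`
    let U : T.Opens := FE.U s
    let ŝ : (U : Scheme.{0}) := ⟨s, FE.mem s⟩
    haveI : Fintype (FE.I s) := Fintype.ofEquiv _ (FE.enum s).symm
    let ε : FE.I s ≃ Fin (Nat.card J + 1) := (FE.enum s).trans (finCongr (hFE s))
    let eU : SheafOfModules.free (Fin (Nat.card J + 1)) ≅ E.over U :=
      (SheafOfModules.freeFunctor (R := T.ringCatSheaf.over U)).mapIso ε.symm.toIso ≪≫ FE.frame s
    -- the frame transports to a frame rigidification of `P|_U`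
    obtain ⟨Grw, hGrw₁, hGrw₂, Fw, hFw, φw, hiso, e, he, hcov, hrig⟩ :=
      exists_frame_transport_of_frame πT P J Gr hGr₁ hGr₂ U eU
    -- notation for the restricted triple
    let PU := P.baseChange U.ι
    let Mw : PU.A.X.left.Modules := tensorPow ((Scheme.Modules.pullback Grw).obj PU.D.P) 3
    let ιU : PU.A.X.left ⟶ projectiveSpaceInt J :=
      projectiveSpace.homEquiv (Over.mk PU.A.X.hom) (projectiveSpace.pointOfSections (Over.mk PU.A.X.hom)
        (ofCocycleSections Fw.U (CocycleSections.ofFrameSystem Fw hFw fun j ↦ (basisSection e j :)) hcov))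
    have hrigU : PU.IsFrameRigidification J ιU := hrig
    have hlin : PU.IsLinearRigidification J ιU := IsFrameRigidification.isLinearRigidification hrigU
    -- Λ1: `U_R(P) ∩ U` is the image of the frame locus of the restricted rigidified triple
    have hfo : frameOpen J P R ⊓ U = U.ι ''ᵁ ProjFrame.frameLocus (markedTuple J PU ιU R) :=
      frameOpen_inf_eq J P R exists_openCover_GL_of_isLinearRigidification U hlin
    have h1 : s ∈ frameOpen J P R ↔ ŝ ∈ ProjFrame.frameLocus (markedTuple J PU ιU R) := by
      constructor
      · intro hs
        have hs' : s ∈ frameOpen J P R ⊓ U := ⟨hs, FE.mem s⟩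
        rw [hfo] at hs'
        obtain ⟨z, hz, hzs⟩ := hs'
        have hz' : z = ŝ := Subtype.ext hzs
        rwa [hz'] at hz
      · intro hŝ
        have hs' : s ∈ frameOpen J P R ⊓ U := by
          rw [hfo]
          exact ⟨ŝ, hŝ, rfl⟩
        exact hs'.1
    -- Λ2: the marked sections of the restricted triple, the transported frame systems on `U`
    let xU : Fin (Nat.card J + 2) → ((U : Scheme.{0}) ⟶ PU.A.X.left) := fun j =>
      (PU.A.sectionPow PU.level.σ (R j)).left
    have hxU : ∀ j, xU j ≫ PU.A.X.hom = 𝟙 _ := fun j => sectionPow_left_comp_hom PU (R j)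
    have hxx : ∀ j, xU j ≫ pullback.fst P.A.X.hom U.ι = U.ι ≫ (P.A.sectionPow P.level.σ (R j)).left := fun j =>
      (P.baseChange_isBaseChangeVia U.ι).1.1.sectionPow_comp (P.baseChange_isBaseChangeVia U.ι).1.2 (R j)
    -- the transport isomorphisms `θ j : U.ι^*((σ^{R j})^*L′) ≅ (σ_U^{R j})^* M_w`
    let θ : ∀ j, (Scheme.Modules.pullback U.ι).obj
        ((Scheme.Modules.pullback (P.A.sectionPow P.level.σ (R j)).left).obj L') ≅ (Scheme.Modules.pullback (xU j)).obj Mw :=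
      fun j =>
        ((Scheme.Modules.pullbackComp U.ι (P.A.sectionPow P.level.σ (R j)).left).app L' ≪≫
          (Scheme.Modules.pullbackCongr (hxx j).symm).app L' ≪≫
            ((Scheme.Modules.pullbackComp (xU j) (pullback.fst P.A.X.hom U.ι)).app L').symm) ≪≫
        (Scheme.Modules.pullback (xU j)).mapIso φw
    let GU : ∀ j, FrameSystem ((Scheme.Modules.pullback (xU j)).obj Mw) := fun j =>
      { U := fun y => U.ι ⁻¹ᵁ (G (R j)).U (U.ι y)
        mem := fun y => (G (R j)).mem (U.ι y)
        I := fun y => (G (R j)).I (U.ι y)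
        rank := fun y => (G (R j)).rank (U.ι y)
        enum := fun y => (G (R j)).enum (U.ι y)
        frame := fun y =>
          haveI : Fintype ((G (R j)).I (U.ι y)) := Fintype.ofEquiv _ ((G (R j)).enum (U.ι y)).symm
          pullbackFrame U.ι ((G (R j)).frame (U.ι y)) ≪≫ (SheafOfModules.overFunctor _ _).mapIso (θ j) }
    have hGU : ∀ j y, (GU j).rank y = 1 := fun j y => hG (R j) (U.ι y)
    let FEU : FrameSystem ((Scheme.Modules.pushforward PU.A.X.hom).obj Mw) :=
      { U := fun _ => ⊤
        mem := fun _ => trivial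
        I := fun _ => Fin (Nat.card J + 1)
        rank := fun _ => Nat.card J + 1
        enum := fun _ => Equiv.refl _
        frame := fun _ => e }
    have hFEU : ∀ y, FEU.rank y = Nat.card J + 1 := fun _ => rfl
    let WU : ↥U → (U : Scheme.{0}).Opens := fun y => U.ι ⁻¹ᵁ W (U.ι y)
    have hWU : ∀ y, WU y ≤ FEU.U y := fun _ => le_top
    have hW'U : ∀ j y, WU y ≤ (GU j).U y := fun j y => Scheme.Hom.preimage_mono U.ι (hW' (R j) (U.ι y))
    have hE7 := inf_frameLocus_eq_inf_iInf_basicOpen_evalDet PU.A.X.hom Fw hFw J e hcov xU hxU GU hGU FEU hFEU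
      WU hWU hW'U ŝ
    -- `markedTuple J PU ιU R = fun j => xU j ≫ ιU` definitionally
    have h2 : ŝ ∈ ProjFrame.frameLocus (markedTuple J PU ιU R) ↔ ∀ k : Fin (Nat.card J + 2),
        ŝ ∈ (U : Scheme.{0}).basicOpen (FrameSystem.evalDet
          (fun j => evalAtSection PU.A.X.hom (xU (k.succAbove j)) (hxU _) Mw) FEU hFEU (fun j => GU (k.succAbove j))
          (fun j => hGU (k.succAbove j)) WU hWU (fun j => hW'U (k.succAbove j)) ŝ) := by
      have hŝW : ŝ ∈ WU ŝ := hmem s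
      constructor
      · intro h
        have hmem2 : ŝ ∈ WU ŝ ⊓ ProjFrame.frameLocus (fun j => xU j ≫ ιU) := ⟨hŝW, h⟩
        rw [hE7] at hmem2
        exact (mem_iInf_iff _ ŝ).mp hmem2.2
      · intro h
        have hmem2 : ŝ ∈ WU ŝ ⊓ ⨅ k : Fin (Nat.card J + 2), (U : Scheme.{0}).basicOpen (FrameSystem.evalDet
            (fun j => evalAtSection PU.A.X.hom (xU (k.succAbove j)) (hxU _) Mw) FEU hFEU (fun j => GU (k.succAbove j))
            (fun j => hGU (k.succAbove j)) WU hWU (fun j => hW'U (k.succAbove j)) ŝ) :=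
          ⟨hŝW, (mem_iInf_iff _ ŝ).mpr h⟩
        rw [← hE7] at hmem2
        exact hmem2.2
    -- Λ3: the minors on `U` are the pulled-back minors
    have h3 : ∀ k : Fin (Nat.card J + 2),
        ŝ ∈ (U : Scheme.{0}).basicOpen (FrameSystem.evalDet
          (fun j => evalAtSection PU.A.X.hom (xU (k.succAbove j)) (hxU _) Mw) FEU hFEU (fun j => GU (k.succAbove j))
          (fun j => hGU (k.succAbove j)) WU hWU (fun j => hW'U (k.succAbove j)) ŝ) ↔
        s ∈ T.basicOpen (FrameSystem.evalDet
          (fun j => evalAtSection P.A.X.hom (P.A.sectionPow P.level.σ (R (k.succAbove j))).left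
            (sectionPow_left_comp_hom P _) L')
          FE hFE (fun j => G (R (k.succAbove j))) (fun _ => hG _) W hW (fun _ => hW' _) s) := by
      intro k
      -- abbreviations for the `k`-th family of marked sections on `T` and on `U`
      let RT : Fin (Nat.card J + 1) → (Fin g ⊕ Fin g → ZMod N) := fun j => R (k.succAbove j)
      let ψT : ∀ j : Fin (Nat.card J + 1), E ⟶ (Scheme.Modules.pullback (P.A.sectionPow P.level.σ (RT j)).left).obj L' :=
        fun j => evalAtSection P.A.X.hom (P.A.sectionPow P.level.σ (RT j)).left (sectionPow_left_comp_hom P _) L'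
      let gT : ∀ j : Fin (Nat.card J + 1), SheafOfModules.free ((G (RT j)).I s) ≅
          ((Scheme.Modules.pullback (P.A.sectionPow P.level.σ (RT j)).left).obj L').over ((G (RT j)).U s) :=
        fun j => (G (RT j)).frame s
      let ιT : ∀ j : Fin (Nat.card J + 1), (G (RT j)).I s := fun j => (G (RT j)).idx (hG (RT j)) s
      let ηT : ∀ j : Fin (Nat.card J + 1), (G (RT j)).I s ≃ Fin 1 := fun j => ((G (RT j)).enum s).trans (finCongr (hG (RT j) s))
      haveI : ∀ j : Fin (Nat.card J + 1), Subsingleton ((G (RT j)).I s) := fun j => (ηT j).subsingleton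
      letI hGfin : ∀ j : Fin (Nat.card J + 1), Fintype ((G (RT j)).I s) := fun j => Fintype.ofEquiv _ ((G (RT j)).enum s).symm
      let kT : ∀ j : Fin (Nat.card J + 1), W s ⟶ (G (RT j)).U s := fun j => homOfLE (hW' (RT j) s)
      let εU : Fin (Nat.card J + 1) ≃ Fin (Nat.card J + 1) := (FEU.enum ŝ).trans (finCongr (hFEU ŝ))
      -- (a) the T-side minor re-read in the frame `eU` (any frame of `E|_U` gives the same non-vanishing locus)
      have hT : T.basicOpen (FrameSystem.evalDet
            (fun j => evalAtSection P.A.X.hom (P.A.sectionPow P.level.σ (R (k.succAbove j))).left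
              (sectionPow_left_comp_hom P _) L')
            FE hFE (fun j => G (R (k.succAbove j))) (fun _ => hG _) W hW (fun _ => hW' _) s) =
          T.basicOpen (Modules.evalDet ψT eU εU (homOfLE (hW s)) gT ιT kT) := by
        rw [FrameSystem.evalDet_eq]
        exact basicOpen_evalDet_eq ψT eU (FE.frame s) εU ε (homOfLE (hW s)) (homOfLE (hW s)) gT gT ιT ιT ηT ηT kT kT
      -- (b) the U-side minor is `U.ι♯` of the T-side one read in `eU`: the frame `e` of `(π_U)_*M_w` IS the frame transported
      -- from `eU` along the base-change isomorphism (`he`), and the frames of the `(σ_U^{R j})^*M_w` are the transported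
      -- `η_{U.ι}(g_j) ≫ θ_j` (definition of `GU`) — ★ `basicOpen_evalDet_baseChange_transport` ((E1)–(E4) of §3a)
      haveI : IsIso (pushforwardBaseChangeHom (IsPullback.of_hasPullback P.A.X.hom U.ι).w L') := hiso
      have he' : FEU.frame ŝ =
          SheafOfModules.restrictTrivialisation (R := (U : Scheme.{0}).ringCatSheaf) (eqToHom U.ι_preimage_self.symm)
              (pullbackFrame U.ι eU) ≪≫
            (SheafOfModules.overFunctor _ ⊤).mapIso
              (asIso (pushforwardBaseChangeHom (IsPullback.of_hasPullback P.A.X.hom U.ι).w L') ≪≫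
                (Scheme.Modules.pushforward (pullback.snd P.A.X.hom U.ι)).mapIso φw) := he
      have hU : (U : Scheme.{0}).basicOpen (FrameSystem.evalDet
            (fun j => evalAtSection PU.A.X.hom (xU (k.succAbove j)) (hxU _) Mw) FEU hFEU (fun j => GU (k.succAbove j))
            (fun j => hGU (k.succAbove j)) WU hWU (fun j => hW'U (k.succAbove j)) ŝ) =
          U.ι ⁻¹ᵁ T.basicOpen (Modules.evalDet ψT eU εU (homOfLE (hW s)) gT ιT kT) := by
        rw [FrameSystem.evalDet_eq, he']
        -- `convert … using 4; rfl`: the two sides agree definitionally (`U.ι ŝ = s`, `PU.A.X = pullback.snd _ _`, the literal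
        -- `GU`/`FEU` fields), but a wholesale `exact` sends the unifier down an expensive path; the residual goals are each `rfl`.
        convert basicOpen_evalDet_baseChange_transport (IsPullback.of_hasPullback P.A.X.hom U.ι).w L' φw
          (fun j => (P.A.sectionPow P.level.σ (RT j)).left) (fun j => sectionPow_left_comp_hom P _)
          (fun j => xU (k.succAbove j)) (fun j => hxU (k.succAbove j)) (fun j => hxx (k.succAbove j)) eU εU
          (homOfLE (hW s)) gT ιT kT (eqToHom U.ι_preimage_self.symm) (homOfLE (hWU ŝ)) using 4
        all_goals rfl
      rw [hU, hT]
      exact Iff.rfl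
    rw [h1, h2]
    exact forall_congr' h3
  -- conclusion
  refine le_antisymm (iSup_le fun t => ?_) fun y hy => ?_
  · intro y hy'
    have hyt : y ∈ W t := (hS R t).le hy' |>.1
    have hy2 : y ∈ T.basicOpen (S.coeff R y) := S.locus R t y ⟨hy', hmem y⟩
    rw [hS R y] at hy2
    exact (key y).mpr fun k => (mem_finset_inf _ _ y).mp hy2.2 k (Finset.mem_univ k)
  · have h2 := (key y).mp hy
    refine Opens.mem_iSup.mpr ⟨y, ?_⟩
    rw [hS R y]
    exact ⟨hmem y, (mem_finset_inf _ _ y).mpr fun k _ => h2 k⟩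

end PolarizedAbelianSchemeWithLevel

end Literature.AlgebraicGeometry.AbelianSchemes
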